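import Literature.MathematicalPhysics.QuantumFieldTheory.Balaban1983to89.Beta.AxialBlockWeights

/-!
# `Balaban1983to89.Beta.AxialComposition` — KERNEL CHECK OF A PRINTED «easily seen»: the k-fold composition of the
printed one-step block-and-contour average IS the scale-`L^k` block-and-contour average ([Balaban1984PropagatorsI]
(INDEX B5) p. 20, (1.16)–(1.18)); the double average of a two-point function is `BlockLegs.blockAvg` over the axial
block data (β sub-cell, row BETA-an3 gen 5, node BETA-an3-g5-QK; BETA-SPEC v1.9g §6.12 OWNERS (vi), RULING (R7);
companion of `Beta.AxialBlockWeights` / `Beta.BlockLegs` / `Beta.TwoPowerLegs`)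

HONEST FRAMING (cell rule, verbatim): discharging `BetaPertH` makes Bałaban's UV stability UNCONDITIONAL — a real
constructive-QFT result; it is NOT the continuum limit and NOT the Clay problem.  (Gloss, BETA-SPEC v1.8d/v1.9b
l. 17–18, GAPS G-ref2-14 (a) / G-ref2-20 (a), verbatim: «UNCONDITIONAL» in [Balaban1989LargeFieldII] (B16) p. 355's
interval-hypothesis sense ONLY (`FlowStepRuns.p355Unconditional_of_partialSums` keeps `hnodes`); the located leaves
G-adv3-2 (left inequality of (0.1)/(2.50), d = 4), G-adv3-1 (U2 transfer of B14 Cor. 3's lower bound) and `SecondExpLeaf`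
REMAIN.  Gloss 2, BETA-SPEC v1.9e, beta-ref C-beta-78, BINDING: «unconditional» = `Beta.Assembly.EventualForm`-unconditional END
statement, NOT «Theorem 2 as printed».)  THIS MODULE DISCHARGES NOTHING of the series.  It TRANSCRIBES two printed
DEFINITIONS (the one-step averaging operation (1.11) and the k-step one (1.18), in integer coordinates) and
KERNEL-CHECKS the printed composition statement between them at the level of the averaging WEIGHTS; the `δ_Ax` factors,
the scaling constants `z^{(k)}` and the Gaussian integrals of (1.16)–(1.17) are NOT modelled.  Value = kernel certificate
(audit cell `pub-balaban`, β sub-cell, unit `b2b-balaban-beta-an3-g5`), NOT summit progress.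

THE PRINTED TEXT ([Balaban1984PropagatorsI], renders `pages/1984-cmp95-propagators-rt-I/…-p002/p003/p004-x2.png`
read as images, journal page = PDF page + 16).  p. 18: «A_{⟨x,x+εe_μ⟩} = A(x, x + εe_μ) = A_μ(x), x ∈ T_ε, μ = 1, …, d. (1.1)»;
«We define a new lattice T_L^{(1)} = T₁ ∩ Lℤ^d and we divide T₁ into blocks B(y) parametrized by the points of
T_L^{(1)}: B(y) = {x ∈ T₁ : y_μ ≤ x_μ < y_μ + L, μ = 1, …, d}, y ∈ T_L^{(1)}. (1.6)».  p. 19: «(QA)_c = Σ_{x∈B(c₋)}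
L^{−(d+1)} A([x, x(c)]), δ(B − QA) = Π_{c⊂T_L^{(1)}} δ(B_c − (QA)_c), (1.11)», with (p. 19, after (1.8)) «where
A(Γ) = Σ_{b⊂Γ} A_b for arbitrary contour Γ, and x(c) denotes a point in the block B(c₊) obtained by translation of x
by the bond c, so if c = ⟨y, y + Le_μ⟩ then x(c) = x + Le_μ.»  p. 20: «((ST)²e^{−S})(C) = … = z^{(2)}∫dA δ(C − Q₂A)
δ_Ax(QA)δ_Ax(A)exp(−S^{L⁻²}(A)), (1.16) where z^{(2)} is a numerical factor coming from scaling transformations and Q₂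
is defined as Q only with the number L replaced by L² in all definitions. It is easily seen that a composition of k
transformations is given by ((ST)^k e^{−S})(B) = z^{(k)}∫dA δ(B − Q_kA)δ_Ax(Q_{k−1}A)·…·δ_Ax(A)e^{−S^η(A)}, (1.17) where
(Q_kA)_b = Σ_{x∈B^k(b₋)} η^{d+1}A([x, x(b)]), b ⊂ T₁^{(k)} = ℤ^d ∩ T_η, η = L^{−k}, (1.18) and x(b) is a point in
B^k(b₊) obtained from x by translation by b. If b = ⟨y, y + e_μ⟩, then x(b) = x + e_μ.»  p. 27: «Let us introduce the
operator Φ = Q_kΔ⁻¹Q_k*. (1.58)» (CONTEXT ONLY).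

TRANSCRIPTION (d = 4, INTEGER COORDINATES of the finest lattice; a bond function in direction `μ` is a function of
the bond's base point, (1.1)).  ONE STEP (1.11) with (1.6): for the new-lattice bond `c = ⟨Ly, Ly + Le_μ⟩`, `y ∈ ℤ⁴`,
`(QA)_c = L^{−5} Σ_{x ∈ Ly + [0,L)⁴} Σ_{0 ≤ j < L} A_μ(x + je_μ)` — this is `axialAvg L μ A_μ y` below (index set
`AxialBlockWeights.idx L = fineBlock L ×ˢ range L`, point map `pt μ (x, j) = x + j·e_μ`).  In new-lattice units the
new bond function is again a function on `ℤ⁴`, so the step is an operator `(Pt → ℝ) → (Pt → ℝ)` and composes with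
itself.  k STEPS (1.18) with `η = L^{−k}`, in integer coordinates `x = ηX`: `(Q_kA)_b = L^{−5k} Σ_{X ∈ L^k y + [0,L^k)⁴}
Σ_{0 ≤ j < L^k} A_μ(X + je_μ)` = `axialAvg (L^k) μ A_μ y`.

WHAT IS KERNEL-CHECKED ([folklore] combinatorics):
* `sum_idx_mul` (§2): the TWO-SCALE BIJECTION `((x′,j′),(x,j)) ↦ (n·x′ + x, n·j′ + j)` from `idx n′ × idx n` onto
  `idx (n·n′)` (inverse: Euclidean division by `n`, coordinatewise), intertwining the point maps:
  `pt μ (n·x′ + x, nj′ + j) = n·pt μ (x′,j′) + pt μ (x,j)`; hence `Σ_{P ∈ idx(nn′)} F(pt P) = Σ_{Q ∈ idx n′} Σ_{q ∈ idx n}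
  F(n·pt Q + pt q)`;
* `axialAvg_comp` (§3): `axialAvg n′ μ (axialAvg n μ f) = axialAvg (n·n′) μ f` (`n ≥ 1`) — in particular (1.16)'s
  «Q₂ is defined as Q only with the number L replaced by L²» (`axialAvg_sq`), and by induction
  **`iterate_axialAvg`: `(axialAvg L μ)^[k] = axialAvg (L^k) μ`** for ALL `L, k` — the printed «It is easily seen that a
  composition of k transformations is given by … (1.18)» at the level of the averaging weights;
* `covAvg` (§4): the double average `Σ_{P,P′ ∈ idx n} g((n·y + pt P) − (n·y′ + pt P′))/n¹⁰` of a two-point function `g`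
  — by bilinearity the two-point function of the averaged field when `g(u − v)` is that of the fine field, i.e. the
  kernel of `(Q ⊗ Q)g = Q G Q*` — equals the iterated single averages (`covAvg_eq_axialAvg₂`, Fubini) and, times the
  canonical `n² = n^{d−2}`, EQUALS `BlockLegs.blockAvg T (AxialBlockWeights.axialBlockData n hn μ) L k (y − y′)` whenever
  `T.g L k = g` (`blockAvg_eq_covAvg`): the object whose (W1)-type legs `BlockLegs` / `AxialBlockWeights` deliver
  unconditionally for the massless `g`.

READING (NOT ASSERTED; the dictionary's business, BETA-SPEC §6.12 OWNERS (iii)/(v), GAPS G-beta-an3-6 (G6-a) UPDATE):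
with (1.58) «Φ = Q_kΔ⁻¹Q_k*», the (μμ) position-space kernel of Φ on the unit lattice `T₁^{(k)}` is `covAvg (L^k) μ G_η`
with `G_η` the kernel of the fine `Δ⁻¹` in η-lattice units; IF `G_η(x) = η^{−2}G₁(x/η)` with `G₁ = c·latticeGreen` (the
normalisation `c` and the gauge of §C of B5 are the dictionary's checks), then Φ_μμ is `c·blockAvg free (axialBlockDataLk μ)`
and `AxialBlockWeights.stepBal_le_of_axialFreeBlockSharpLk` supplies its four (W1)-type legs.  Whether the (R7) `C_k`
of the β̄-window is Φ (plus which longitudinal / local / Woodbury corrections, (1.60), (1.66)) is NOT claimed here.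

WHAT THIS MODULE DOES NOT DO.  No Gaussian integral, no `δ_Ax`, no `z^{(k)}`, no `H_k`/`Δ_k`/`C_k`; no claim about
Bałaban's propagators or β-functions; tree contours `Γ_{y,x}` ((1.7)–(1.8)) are not needed for `Q` ((1.11) uses straight
contours only) and are not modelled.

CITATION HEADER (cell ABSOLUTE RULE: the manuscripts under audit are context, never authority; DEFINITIONS (1.6),
(1.11), (1.18) are transcribed verbatim with page references, the printed composition claim (1.16)–(1.18) is
RE-PROVED here, not cited).
* [Balaban1984PropagatorsI] T. Bałaban, Propagators and renormalization transformations for lattice gauge theories. I,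
  Comm. Math. Phys. 95 (1984) 17–40 (INDEX B5) — (1.1), (1.6) p. 18; (1.8), (1.11) p. 19; (1.16)–(1.18) p. 20; (1.58) p. 27.
* CONTEXT, NOT USED AS A HYPOTHESIS (presearch, corpus): J. Dimock, Nonperturbative renormalization of scalar QED in
  d=3, arXiv:1502.02946 — §2.3 p. 6 «Q_{k+1}(A) = Q(A)Q_k(A) (39)», Lemma 2 p. 7 (explicit k-fold block formula, «The proof
  is by induction on k»), p. 19 «the k-fold averaging operator is defined by Q_k = Q ∘ ⋯ ∘ Q. Then Q_kA is given on oriented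
  bonds in T⁰_{N−k} by (Q_kA)(y, y + e_μ) = ∫_{|x−y|<1/2} L^{−k}A(Γ_{x,x+e_μ}) dx (151)» (d = 3, U(1), blocks centred at y):
  an independent printed statement of the same elementary composition identity; confirms that B5 p. 20's «easily seen»
  is the combinatorial statement re-proved below (d = 4, blocks `[0,L)⁴` as in (1.6)).
* Internal division of labour (NOT citations): BETA-SPEC.md v1.9g §6.12 / §7.12 (R7); AN3.md v5.2 §12; an3 lineage
  HANDOFF GEN 5.

Tags: [cite: Key, loc] on `axialAvg` = a printed DEFINITION written in integer coordinates, asserting nothing; [folklore] =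
elementary combinatorics / algebra proved here.  No `axiom`, no `sorry`; every theorem's hypotheses are explicit binders.
-/

noncomputable section

namespace Literature.MathematicalPhysics.QuantumFieldTheory.Balaban1983to89.Beta.AxialComposition

open Finset
open Literature.Probability.LatticeModels (annulus box latticeGreen)
open Literature.MathematicalPhysics.QuantumFieldTheory.Balaban1983to89
open Literature.MathematicalPhysics.QuantumFieldTheory.Balaban1983to89.Beta
open Literature.MathematicalPhysics.QuantumFieldTheory.Balaban1983to89.Beta.DyadicShell
open Literature.MathematicalPhysics.QuantumFieldTheory.Balaban1983to89.Beta.BubbleTransfer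
open Literature.MathematicalPhysics.QuantumFieldTheory.Balaban1983to89.Beta.TwoPowerLegs
open Literature.MathematicalPhysics.QuantumFieldTheory.Balaban1983to89.Beta.BlockLegs
open Literature.MathematicalPhysics.QuantumFieldTheory.Balaban1983to89.Beta.AxialBlockWeights

/-! ## §1. The printed averaging operations in integer coordinates -/

/-- TRANSCRIPTION (d = 4, integer coordinates; asserts nothing): the block-and-contour average at scale `n` of a
bond function `f` (direction `μ`, bond ↦ base point, (1.1)) at the new-lattice point `y`:
`n^{−5} Σ_{x ∈ n·y + [0,n)⁴} Σ_{0 ≤ j < n} f(x + j·e_μ)` — one step (1.11) is `n = L`, `k` steps (1.18) is `n = L^k`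
(`η = L^{−k}`). [cite: Balaban1984PropagatorsI, (1.11) p. 19 with (1.6) p. 18 (one step); (1.18) p. 20 (k steps);
transcription in integer coordinates, the printed `δ_Ax`, `z^{(k)}` and Gaussian integrals not modelled] -/
def axialAvg (n : ℕ) (μ : Fin 4) (f : Pt → ℝ) (y : Pt) : ℝ :=
  (∑ q ∈ idx n, f (n • y + pt μ q)) / (n : ℝ) ^ 5

/-- `idx 0 = ∅`. [folklore] -/
theorem idx_zero : idx 0 = ∅ := by
  simp [idx]

/-- `idx 1 = {(0, 0)}`. [folklore] -/
theorem idx_one : idx 1 = {((0 : Pt), (0 : ℕ))} := by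
  ext ⟨x, j⟩
  simp only [idx, mem_product, mem_fineBlock, mem_range, mem_singleton, Prod.mk.injEq, Nat.lt_one_iff,
    Nat.cast_one]
  constructor
  · rintro ⟨hx, hj⟩
    refine ⟨funext fun i => ?_, hj⟩
    have := hx i
    simp only [Pi.zero_apply]
    omega
  · rintro ⟨rfl, rfl⟩
    exact ⟨fun i => by simp, rfl⟩

/-- at scale `0` the average is `0` (empty index set). [folklore] -/
theorem axialAvg_zero (μ : Fin 4) (f : Pt → ℝ) : axialAvg 0 μ f = fun _ => 0 := by
  funext y; simp [axialAvg, idx_zero]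

/-- at scale `1` the average is the identity. [folklore] -/
theorem axialAvg_one (μ : Fin 4) (f : Pt → ℝ) : axialAvg 1 μ f = f := by
  funext y; simp [axialAvg, idx_one, pt]

/-- the printed average IS the `AxialBlockWeights` weighting of the axial support:
`axialAvg n μ f y = Σ_{m ∈ axialSupport n μ} axialWeight n μ m · f(n·y + m)`. [folklore] -/
theorem axialAvg_eq_weights (n : ℕ) (μ : Fin 4) (f : Pt → ℝ) (y : Pt) :
    axialAvg n μ f y = ∑ m ∈ axialSupport n μ, axialWeight n μ m * f (n • y + m) := by
  rw [sum_axialWeight_mul n μ (fun m => f (n • y + m))]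
  unfold axialAvg
  rw [Finset.sum_div]

/-! ## §2. The two-scale bijection -/

/-- combine a coarse index (to be dilated by `n`) with a fine index. [folklore] -/
def combine (n : ℕ) (a : (Pt × ℕ) × (Pt × ℕ)) : Pt × ℕ := (n • a.1.1 + a.2.1, n * a.1.2 + a.2.2)

/-- split an index at scale `n·n′` into (coarse, fine) by Euclidean division by `n`. [folklore] -/
def split (n : ℕ) (P : Pt × ℕ) : (Pt × ℕ) × (Pt × ℕ) :=
  ((fun i => P.1 i / n, P.2 / n), (fun i => P.1 i % n, P.2 % n))

/-- the point map intertwines: `pt μ (combine n (Q, q)) = n·pt μ Q + pt μ q`. [folklore] -/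
theorem pt_combine (n : ℕ) (μ : Fin 4) (a : (Pt × ℕ) × (Pt × ℕ)) :
    pt μ (combine n a) = n • pt μ a.1 + pt μ a.2 := by
  ext i
  simp only [pt_apply, combine, Pi.add_apply, Pi.smul_apply, Nat.cast_add, Nat.cast_mul]
  split_ifs <;> ring

/-- `n·a + b < n·m` for `a < m`, `b < n`, `0 ≤ n`. [folklore] -/
theorem combine_lt {n a b m : ℤ} (hn : 0 ≤ n) (ha : a < m) (hb : b < n) : n * a + b < n * m := by
  nlinarith [mul_nonneg hn (by linarith : 0 ≤ m - a - 1)]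

/-- Euclidean division undoes `combine` (quotient). [folklore] -/
theorem ediv_combine {n a b : ℤ} (hn : 0 < n) (hb0 : 0 ≤ b) (hb : b < n) : (n * a + b) / n = a := by
  rw [add_comm, Int.add_mul_ediv_left _ _ hn.ne', Int.ediv_eq_zero_of_lt hb0 hb, zero_add]

/-- Euclidean division undoes `combine` (remainder). [folklore] -/
theorem emod_combine {n a b : ℤ} (hb0 : 0 ≤ b) (hb : b < n) : (n * a + b) % n = b := by
  rw [add_comm, Int.add_mul_emod_self_left, Int.emod_eq_of_lt hb0 hb]

/-- the same over `ℕ` (quotient). [folklore] -/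
theorem div_combine_nat {n a b : ℕ} (hn : 0 < n) (hb : b < n) : (n * a + b) / n = a := by
  rw [add_comm, Nat.add_mul_div_left _ _ hn, Nat.div_eq_of_lt hb, zero_add]

/-- the same over `ℕ` (remainder). [folklore] -/
theorem mod_combine_nat {n a b : ℕ} (hb : b < n) : (n * a + b) % n = b := by
  rw [add_comm, Nat.add_mul_mod_self_left, Nat.mod_eq_of_lt hb]

/-- THE TWO-SCALE IDENTITY: summing `F ∘ pt μ` over `idx (n·n′)` = summing `F(n·pt Q + pt q)` over coarse `Q ∈ idx n′`
and fine `q ∈ idx n` (`n ≥ 1`). [folklore] -/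
theorem sum_idx_mul {n : ℕ} (hn : 1 ≤ n) (n' : ℕ) (μ : Fin 4) (F : Pt → ℝ) :
    ∑ Q ∈ idx n', ∑ q ∈ idx n, F (n • pt μ Q + pt μ q) = ∑ P ∈ idx (n * n'), F (pt μ P) := by
  rw [← Finset.sum_product']
  have hn0 : (0 : ℤ) < n := by exact_mod_cast hn
  have hnn : 0 < n := hn
  refine Finset.sum_nbij' (combine n) (split n) ?_ ?_ ?_ ?_ ?_
  · intro a ha
    simp only [mem_product, idx, mem_fineBlock, mem_range] at ha
    obtain ⟨⟨hx', hj'⟩, hx, hj⟩ := ha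
    simp only [idx, mem_product, mem_fineBlock, mem_range, combine, Pi.add_apply, Pi.smul_apply, Nat.cast_mul]
    refine ⟨fun i => ⟨?_, ?_⟩, ?_⟩
    · have h1 := (hx' i).1; have h2 := (hx i).1; positivity
    · exact combine_lt hn0.le (hx' i).2 (hx i).2
    · nlinarith
  · intro P hP
    simp only [idx, mem_product, mem_fineBlock, mem_range, Nat.cast_mul] at hP
    obtain ⟨hX, hJ⟩ := hP
    simp only [mem_product, idx, mem_fineBlock, mem_range, split]
    refine ⟨⟨fun i => ⟨Int.ediv_nonneg (hX i).1 hn0.le, ?_⟩, ?_⟩, fun i => ⟨Int.emod_nonneg _ hn0.ne', ?_⟩, ?_⟩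
    · rw [Int.ediv_lt_iff_lt_mul hn0]; linarith [(hX i).2, mul_comm (n : ℤ) n']
    · rw [Nat.div_lt_iff_lt_mul hnn]; linarith [mul_comm n n']
    · exact Int.emod_lt_of_pos _ hn0
    · exact Nat.mod_lt _ hnn
  · intro a ha
    simp only [mem_product, idx, mem_fineBlock, mem_range] at ha
    obtain ⟨⟨hx', hj'⟩, hx, hj⟩ := ha
    simp only [split, combine, Pi.add_apply, Pi.smul_apply]
    refine Prod.ext (Prod.ext (funext fun i => ?_) ?_) (Prod.ext (funext fun i => ?_) ?_)
    · exact ediv_combine hn0 (hx i).1 (hx i).2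
    · exact div_combine_nat hnn hj
    · exact emod_combine (hx i).1 (hx i).2
    · exact mod_combine_nat hj
  · intro P _
    simp only [split, combine]
    refine Prod.ext (funext fun i => ?_) ?_
    · simp only [Pi.add_apply, Pi.smul_apply]
      exact Int.mul_ediv_add_emod _ _
    · exact Nat.div_add_mod _ _
  · intro a _
    rw [pt_combine]

/-! ## §3. Composition: (1.16) «Q₂ = Q with L replaced by L²» and (1.18) by induction -/

/-- COMPOSITION OF TWO SCALES: averaging at scale `n` then at scale `n′` (on the new lattice) is averaging at scale
`n·n′` (`n ≥ 1`). [folklore] -/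
theorem axialAvg_comp {n : ℕ} (hn : 1 ≤ n) (n' : ℕ) (μ : Fin 4) (f : Pt → ℝ) (y : Pt) :
    axialAvg n' μ (axialAvg n μ f) y = axialAvg (n * n') μ f y := by
  unfold axialAvg
  rw [← Finset.sum_div, div_div]
  have e : ∀ Q q : Pt × ℕ, n • (n' • y + pt μ Q) + pt μ q = (n * n') • y + (n • pt μ Q + pt μ q) := by
    intro Q q; rw [smul_add, smul_smul, add_assoc]
  simp_rw [e]
  rw [sum_idx_mul hn n' μ (fun m => f ((n * n') • y + m))]
  congr 1
  push_cast
  ring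

/-- (1.16): «Q₂ is defined as Q only with the number L replaced by L²» — two steps at scale `L` are one step at
scale `L²`. [folklore] -/
theorem axialAvg_sq (L : ℕ) (μ : Fin 4) (f : Pt → ℝ) : axialAvg L μ (axialAvg L μ f) = axialAvg (L ^ 2) μ f := by
  rcases Nat.eq_zero_or_pos L with rfl | hL
  · simp [axialAvg_zero]
  · funext y; rw [axialAvg_comp hL, sq]

/-- (1.17)–(1.18): «It is easily seen that a composition of k transformations is given by … (Q_kA)_b =
Σ_{x∈B^k(b₋)} η^{d+1}A([x, x(b)]), η = L^{−k}» — the `k`-fold iterate of the one-step average at scale `L` IS the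
average at scale `L^k`, for ALL `L, k` (at the level of the averaging weights). [folklore] -/
theorem iterate_axialAvg (L : ℕ) (μ : Fin 4) (k : ℕ) (f : Pt → ℝ) :
    (axialAvg L μ)^[k] f = axialAvg (L ^ k) μ f := by
  induction k generalizing f with
  | zero => simp [axialAvg_one]
  | succ k ih =>
    rw [Function.iterate_succ_apply', ih, pow_succ]
    rcases Nat.eq_zero_or_pos L with rfl | hL
    · simp [axialAvg_zero]
    · funext y
      exact axialAvg_comp (Nat.one_le_pow _ _ hL) L μ f y

/-- The iterate in the explicit form of (1.18): `L^{−5k} Σ_{X ∈ L^k·y + [0,L^k)⁴, j < L^k} f(X + je_μ)`. [folklore] -/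
theorem iterate_axialAvg_apply (L : ℕ) (μ : Fin 4) (k : ℕ) (f : Pt → ℝ) (y : Pt) :
    (axialAvg L μ)^[k] f y = (∑ q ∈ idx (L ^ k), f (L ^ k • y + pt μ q)) / ((L : ℝ) ^ k) ^ 5 := by
  rw [iterate_axialAvg]; simp [axialAvg]

/-! ## §4. The double average of a two-point function = `BlockLegs.blockAvg` over the axial block data -/

/-- The double block-and-contour average of a two-point function `g` at scale `n`, new-lattice points `y, y′`:
`n^{−10} Σ_{P,P′ ∈ idx n} g((n·y + pt P) − (n·y′ + pt P′))` — the kernel of `(Q ⊗ Q)g`. [folklore] -/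
def covAvg (n : ℕ) (μ : Fin 4) (g : Pt → ℝ) (y y' : Pt) : ℝ :=
  (∑ P ∈ idx n, ∑ P' ∈ idx n, g ((n • y + pt μ P) - (n • y' + pt μ P'))) / (n : ℝ) ^ 10

/-- FUBINI: the double average is the single average in each variable — `covAvg n μ g y y′ =
axialAvg n μ (fun u => axialAvg n μ (fun v => g (u − v)) y′) y`. [folklore] -/
theorem covAvg_eq_axialAvg₂ (n : ℕ) (μ : Fin 4) (g : Pt → ℝ) (y y' : Pt) :
    covAvg n μ g y y' = axialAvg n μ (fun u => axialAvg n μ (fun v => g (u - v)) y') y := by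
  unfold covAvg axialAvg
  rw [← Finset.sum_div, div_div, ← pow_add]

/-- the double average depends on `y − y′` only, in the `blockAvg` form. [folklore] -/
theorem covAvg_eq (n : ℕ) (μ : Fin 4) (g : Pt → ℝ) (y y' : Pt) :
    covAvg n μ g y y' = (∑ P ∈ idx n, ∑ P' ∈ idx n, g (n • (y - y') + pt μ P - pt μ P')) / (n : ℝ) ^ 10 := by
  unfold covAvg
  congr 1
  refine Finset.sum_congr rfl fun P _ => Finset.sum_congr rfl fun P' _ => ?_
  congr 1
  rw [smul_sub]; abel

/-- THE LINK: `n²·covAvg` IS `BlockLegs.blockAvg` over `AxialBlockWeights.axialBlockData` whenever the two-power family's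
`g L k` is the two-point function `g` — so `BlockLegs`/`AxialBlockWeights` deliver the (W1)-type legs of exactly this
double average (for the massless `g`, unconditionally). [folklore] -/
theorem blockAvg_eq_covAvg (T : TwoPower) (n : ℕ → ℕ → ℕ) (hn : ∀ L k, 1 ≤ n L k) (μ : Fin 4) (L k : ℕ)
    (g : Pt → ℝ) (hg : T.g L k = g) (y y' : Pt) :
    blockAvg T (axialBlockData n hn μ) L k (y - y') = (n L k : ℝ) ^ 2 * covAvg (n L k) μ g y y' := by
  rw [blockAvg_axial, covAvg_eq, ← hg, ← mul_div_assoc, Finset.mul_sum, Finset.sum_div]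
  refine Finset.sum_congr rfl fun P _ => ?_
  rw [Finset.mul_sum, Finset.sum_div]

/-- The same at the printed scale `n = L^k` (`axialBlockDataLk`, `L ≥ 1`): the `k`-fold iterate of the one-step average,
applied in both variables to `g(u − v)`, times `L^{2k}`, is `blockAvg T (axialBlockDataLk μ) L k (y − y′)`. [folklore] -/
theorem blockAvg_eq_iterate (T : TwoPower) (μ : Fin 4) {L : ℕ} (hL : 1 ≤ L) (k : ℕ) (g : Pt → ℝ)
    (hg : T.g L k = g) (y y' : Pt) :
    blockAvg T (axialBlockDataLk μ) L k (y - y') =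
      ((L : ℝ) ^ k) ^ 2 * (axialAvg L μ)^[k] (fun u => (axialAvg L μ)^[k] (fun v => g (u - v)) y') y := by
  have h1 : scaleLk L k = L ^ k := scaleLk_eq hL k
  rw [axialBlockDataLk, blockAvg_eq_covAvg T scaleLk one_le_scaleLk μ L k g hg, covAvg_eq_axialAvg₂, h1]
  simp_rw [iterate_axialAvg]
  push_cast
  rfl

end Literature.MathematicalPhysics.QuantumFieldTheory.Balaban1983to89.Beta.AxialComposition

end
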